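import Summits.Ventures.HSemireg.UntwistExtEquivalence
import HarnessLib

/-!
# Venture HSemireg — the `π^*` half of route R1.0 (i): `Ext` along the pull-back to the `μ₂`-gerbe is a
# bijection (block inclusion with a monomorphism-preserving left adjoint), composed with the untwist, and
# the kernel clause with that REAL comparison map

HONEST FRAMING. Homological algebra (Mathlib's `Ext`, `Functor.mapExtAddHom`, adjunctions) composed with
the triangular transport of `UntwistFullSigma.lean` and the equivalence half of `UntwistExtEquivalence.lean`.
No gerbe, no band, no twist functor and no variety is constructed: the geometric inputs of route R1.0 enter as
the HYPOTHESES of theorems (an adjunction, an equivalence, a triangular formula), never as named facts. Nothing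
here says HC, HC_CM or HC_AV is proved.

## The step being served (cell pub-hsemireg, `general-structure/PERRY-SUBSTITUTE-GS.md` §1 (R1.0); gs-red
## RED-GS.md GS-23(a); `theory/HANDOFF-th-4.md` §1, the item left open by the first three files)

R1.0 (i), by value (the numbers are the cell's refereed STEP-0 (C) data, quoted for orientation only): `X₀ = X × X̂`
an abelian fourfold, `P` the Poincaré bundle, `E₀ = Φ(I_p ⊠ I_q)` (perfect, amplitude `[-1, 0]`, rank `-2`,
`c₁(E₀) = c₁(P)`), `dim Ext²_{X₀}(E₀, E₀) = 18`; `π : 𝔊₀ → X₀` the `μ₂`-gerbe of square roots of `P` (class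
`c₁(P) mod 2 ∈ H²_ét(X₀, μ₂)`, B-field `B₀ = c₁(P)/2`), `L` the tautological root on `𝔊₀` (`L² = π^*P`,
`c₁(L) = c₁(P)/2`), `E₀′ = π^*E₀ ⊗ L^{∓1}` (weight `∓1`). CLAIM (i): the comparison
`θ : Ext²_{X₀}(E₀, E₀) → Ext²_{𝔊₀}(E₀′, E₀′)`, `θ(ξ) = π^*ξ ⊗ 1`, is a bijection — gs-red GS-23(a): «`π`
cohomologically affine, `π_* π^* = id` on weight `0`» (the `π^*` half) and «`- ⊗ L` an autoequivalence» (the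
half made real in `UntwistExtEquivalence.lean`).

## What is PROVED here (0 sorry, 0 named facts, no definitions)

* `mapExtAddHom_bijective_of_leftAdjoint` — **block inclusion.** `F : C ⥤ D` additive, exact, full and
  faithful between abelian categories, `C` with enough injectives, and `F` a RIGHT adjoint, `G ⊣ F`, of a
  functor `G` that preserves monomorphisms ⟹ `Extⁿ_C(X, Y) → Extⁿ_D(F X, F Y)` is BIJECTIVE for all `X Y n`
  (Mathlib: `G ⊣ F` with `G` mono-preserving makes `F` preserve injective objects —
  `Functor.preservesInjectiveObjects_of_adjunction_of_preservesMonomorphisms` — and then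
  `Functor.mapExt_bijective_of_preservesInjectiveObjects`).
* `mapExtAddHom_comp_equivalence_bijective_of_leftAdjoint` — **block inclusion followed by an
  autoequivalence** `Φ : D ≌ D′`: `(F ⋙ Φ.functor).mapExtAddHom X Y n` is bijective (left adjoint
  `Φ.inverse ⋙ G`). This is the SHAPE of the map `θ` of R1.0 (i) — `ξ ↦ Φ(π^*ξ) = π^*ξ ⊗ 1_{L^{∓1}}` on
  `Ext²(E, E) → Ext²(Φ(π^*E), Φ(π^*E))` for a sheaf `E` — as a REAL bijection, no longer an abstract
  `θ : A ≃+ A′` (for the complex `E₀` itself see REACH below).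
* `jointlyInjective_iff_of_leftAdjoint_comp_equivalence` (+ the one-sided
  `jointlyInjective_of_leftAdjoint_comp_equivalence`, the direction R1.0 CONSUMES: scheme ⟹ gerbe, which needs
  `θ` SURJECTIVE, i.e. exactly the content of the block-inclusion comparison; + the retraction form
  `jointlyInjective_iff_of_leftAdjoint_comp_equivalence_of_retraction`, diagonal injective because
  `r_q ∘ d_q = id`) — **the kernel clause with the real `θ`**: for component families
  `σ_q : Ext²_C(E, E) → W_q`, `σ′_q : Ext²_{D′}(Φ F E, Φ F E) → W′_q` with
  `σ′_q(θ ξ) = d_q(σ_q ξ) + Σ_{j<q} u_{q,j}(σ_j ξ)` on a LOWER set `I`, `d_q` injective on `I`, `u` arbitrary: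
  `(σ_q)_{q ∈ I}` jointly injective ⟺ `(σ′_q)_{q ∈ I}` jointly injective (`UntwistFullSigma`, carrier-free
  layer). REACH: the REAL `θ` of these statements is for SHEAF carriers — `E` an object of an abelian category and
  Mathlib's `Ext` of such objects; for the route's two-term perfect complex `E₀` only
  `UntwistFullSigma.jointlyInjective_iff_of_triangular` (abstract bijection `θ`) applies, with the bijectivity of
  `θ` on `Ext²(E₀, E₀) = Hom_{D(X₀)}(E₀, E₀[2])` a HYPOTHESIS (printed: the derived adjunction
  `Ext_𝔊(π^*A, π^*B) = Ext_X(A, Rπ_*π^*B) = Ext_X(A, B)`, `R^{>0}π_* = 0` + projection formula [Alper2013,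
  Prop. 4.5, published numbering]; Mathlib has no `mapExt` for complexes) — ref-2 (S1)/(P2), red-4 R4-11(b).
* `isISemiregular_iff_jointlyInjective_of_leftAdjoint_comp_equivalence`,
  `isISemiregular_univ_iff_jointlyInjective_of_leftAdjoint_comp_equivalence`,
  `jointlyInjective_of_isISemiregular_univ_of_leftAdjoint_comp_equivalence` — **real SOURCE carriers**:
  `E` finite locally free on `X/S`, `σ_q = sigmaHigher hE q : Ext²(E, E) → H^{q+2}(X, Ω^q_{X/S})`
  (`HodgeTheory/SemiregularityHigherSigma.lean`), `F : Mod(𝒪_X) ⥤ D` a block inclusion as above (enough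
  injectives in `Mod(𝒪_X)`: tree instance, Hartshorne III.2.2), `Φ : D ≌ D′`, target family `σ′_q` abstract
  (there is no gerbe carrier in the tree): `IsISemiregular hE I ⟺ (σ′_q)_{q ∈ I}` jointly injective on
  `Ext²_{D′}(Φ F E, Φ F E)`; FULL `σ` (`I = univ`); and «`E` fully semiregular ⟹ `Φ F E` fully semiregular».

## How R1.0 maps onto the hypotheses (what is NOT proved here, and where it is printed)

* `C = Mod(𝒪_{X₀})`, `D = D′ = Mod(𝒪_{𝔊₀})`, `F = π^*` — exact (`π` is flat, indeed étale-locally on `X₀` the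
  projection `U × Bμ₂ → U`) and fully faithful (unit `E → π_*π^*E` an isomorphism). `G = π_*`, which for the
  `μ₂`-gerbe is (a) EXACT — the gerbe is tame / `π` is cohomologically affine [AbramovichOlssonVistoli2008,
  Def. 3.1, Thm. 3.2; Alper2013, Def. 3.1, Rem. 3.5] (cell: lit-1 GERBE-SCOPE-LOCATORS §2) — and (b) LEFT
  adjoint to `π^*`: every `𝒪_{𝔊₀}`-module splits under the central `μ₂ ⊂` inertia into eigensheaves,
  `𝓕 = 𝓕₀ ⊕ 𝓕₁` [Lieblich2007, arXiv §2.2.1, Prop. 2.2.1.6: «when `A` is diagonalizable we can split up the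
  category of quasi-coherent sheaves into pieces indexed by characters … `⊕_χ 𝓕_χ ⥲ 𝓕`», held text
  arXiv:math/0411337 p.10 L48–62], morphisms respect the splitting (they commute with the inertia action), the
  weight-`0` part is pulled back from `X₀` — `π^*π_*𝓕 ⥲ 𝓕₀` [Lieblich2007, arXiv Lemma 2.1.1.12: «if the inertia
  action `F × 𝓘(𝒮) → F` is trivial, then `F` is naturally the pullback of a unique sheaf on `X` … we claim that
  `π^*π_*F → F` is an isomorphism», p.7 L125–134] — hence
  `Hom_{𝔊₀}(𝓕, π^*E) = Hom(𝓕₀, π^*E) = Hom_{X₀}(π_*𝓕, E)`, i.e. `π_* ⊣ π^*`. So gs-red's «`π` cohomologically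
  affine, `π_*π^* = id` on weight `0`» enters EXACTLY as the hypothesis «an adjunction `G ⊣ F` with `G`
  preserving monomorphisms» (any exact `G` does). The weight decomposition itself is NOT constructed here (no
  band / inertia in the tree; `UntwistGerbeWeights.lean` derives `G ⊣ F` from splitting data `(ι, p)`).
  SCOPE OF THE CITATIONS (ref-2 (P1)): Lieblich's Prop. 2.2.1.6 and Alper's / AOV's exactness are PRINTED for
  QUASI-COHERENT sheaves (`QCoh(𝔊₀)`, `π_* : QCoh → QCoh`); reading the dictionary with ALL `𝒪_{𝔊₀}`-modules, as
  written above, is a SEAT DERIVATION, not the printed statement: étale-locally on `X₀` the gerbe is `[U/μ₂]`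
  (trivial action), an `𝒪`-module there is a `μ₂`-equivariant `𝒪_U`-module, i.e. an `𝒪_U`-module with an
  involution, split by the idempotents `(1 ± ι)/2` — this uses `2 ∈ 𝒪^×`. Alternatively read `C = QCoh(X₀)`,
  `D = D′ = QCoh(𝔊₀)` (Grothendieck abelian, enough injectives) and compare `Ext` in `QCoh` with `Ext` in `Mod`
  (they agree for quasi-coherent arguments on a Noetherian scheme — a further standard fact, not in this file).
  TAME CAVEAT (gs-lead 12:53:26Z, th-1 12:58:02Z): both the splitting and the vanishing `Hom(𝓕₁, π^*E) = 0`
  (`2φ = 0 ⇒ φ = 0`) use that `2` is invertible / `μ₂` is linearly reductive (here: over `ℂ`); nothing in this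
  dictionary is claimed for wild gerbes — the Lean theorems themselves are agnostic, they only see `G ⊣ F`. The
  printed form of the same comparison is the derived adjunction the other way round,
  `Ext_𝔊(π^*A, π^*B) = Ext_X(A, Rπ_*π^*B) = Ext_X(A, B)` (`R^{>0}π_* = 0`, projection formula [Alper2013,
  Prop. 4.5, published numbering; AOV and Alper are cited by PUBLISHED numbers, the held texts being the arXiv
  versions]; lit-1 GERBE-SCOPE (P3)); both rest on (a) + `π_*π^* = id`.
* `Φ = - ⊗ L^{∓1}` on `Mod(𝒪_{𝔊₀})` (an autoequivalence, inverse `- ⊗ L^{±1}`), so `Φ(F E₀) = π^*E₀ ⊗ L^{∓1} = E₀′`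
  and `θ = (F ⋙ Φ).mapExt`. NOT constructed (no line-bundle twist functor with unitors on module categories in
  the tree; cell memos th-2 K2/K5, gs-g4 G4-SUMMARY).
* `d_q = π^* : H^{q+2}(X₀, Ω^q) → H^{q+2}(𝔊₀, Ω^q)`, injective because `π_* ∘ π^* = id` (retraction `r_q = π_*`;
  in fact an isomorphism for the tame gerbe: lit-1 GERBE-SCOPE (L2)/(L3), `Ω_𝔊 = π^*Ω_X`). Only a retraction /
  injectivity is used.
* `hσ` = the Leibniz rule `At(𝓕 ⊗ M) = At(𝓕) ⊗ 1 + 1 ⊗ c₁(M)` [Atiyah1957, Prop. 11 «`b(E ⊗ E′) = b(E) ⊗ I′ +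
  I ⊗ b(E′)`» (Prop. 10 the same for the extensions `𝓑`), Prop. 12 «`b(E) = -2πi c(E)`» for a line bundle;
  Trans. AMS 85, pp. 195–196, held text p0015 L85–90, p0016 L22–59; for finite complexes of locally free sheaves
  Huybrechts–Lehn, *The geometry of moduli spaces of sheaves*, 2nd ed., §10.1.5] giving
  `u_{q,j} = ±(q choose j)(c₁(M)^{q-j} ∪ -)`; a HYPOTHESIS, as in the first three files.
* CARRIERS: the real-carrier statements take `E` finite locally free because `sigmaHigher` exists only there, and
  EVERY statement of this file takes `E` an object of an abelian category (a sheaf avatar). The route's object `E₀`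
  is a two-term complex: none of this file's theorems reaches it; for `E₀` the carrier-free lemma of
  `UntwistFullSigma` applies with `θ`-bijectivity as a hypothesis (see REACH above) — a `σ_q` for perfect
  complexes alone would not suffice (ref-2 (S1)/(P2), red-4 R4-4/R4-11(b)).
* (R1.0.ii) `ch(E₀′) = κ(E₀)`: `UntwistKappaClass.lean`. (R1.0.iii) kernel clause / lower sets exactly:
  `UntwistFullSigma.lean`.

## References

* M. Lieblich, *Moduli of twisted sheaves*, Duke Math. J. 138 (2007) 23–118; arXiv:math/0411337, Lemma
  2.1.1.12 and §2.2.1 Prop. 2.2.1.6 (arXiv numbering). [Lieblich2007]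
* D. Abramovich, M. Olsson, A. Vistoli, *Tame stacks in positive characteristic*, Ann. Inst. Fourier 58
  (2008), Def. 3.1, Thm. 3.2. [AbramovichOlssonVistoli2008]
* J. Alper, *Good moduli spaces for Artin stacks*, Ann. Inst. Fourier 63 (2013), Def. 3.1, Rem. 3.5,
  Prop. 4.5. [Alper2013]
* R. Hartshorne, *Algebraic Geometry*, III.2.2 (enough injectives in `Mod(𝒪_X)`). [Hartshorne1977]
* R.-O. Buchweitz, H. Flenner, Compositio Math. 137 (2003), Def. 4.1, §5 (`I`-semiregular).
  [BuchweitzFlenner2003]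
* M. F. Atiyah, *Complex analytic connections in fibre bundles*, Trans. AMS 85 (1957), Prop. 10–12
  (pp. 195–196). [Atiyah1957]
-/

open CategoryTheory CategoryTheory.Abelian CategoryTheory.Limits AlgebraicGeometry

namespace Summit.Ventures.HSemireg

/-! ### Block inclusion: `Ext` along a fully faithful exact functor with a mono-preserving left adjoint -/

section BlockInclusion

universe w w' w'' v v' v'' u u' u''

variable {C : Type u} [Category.{v} C] [Abelian C] {D : Type u'} [Category.{v'} D] [Abelian D]
  {D' : Type u''} [Category.{v''} D'] [Abelian D']

/-- **`Ext`-comparison for a block inclusion.** Let `F : C ⥤ D` be an additive, exact, fully faithful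
functor between abelian categories which is a RIGHT adjoint, `G ⊣ F`, of a functor `G` preserving
monomorphisms (e.g. `G` exact), and let `C` have enough injectives. Then
`Extⁿ(X, Y) → Extⁿ(F X, F Y)` (Mathlib `Functor.mapExtAddHom`) is bijective for all `X Y n`: `F` preserves
injective objects (`Hom_D(-, F I) = Hom_C(G -, I)` is exact), so Mathlib's dimension-shifting criterion
applies. Intended instance (route R1.0 (i), `π^*` half): `F = π^* : Mod(𝒪_{X₀}) → Mod(𝒪_{𝔊₀})` for the
`μ₂`-gerbe `π : 𝔊₀ → X₀`, `G = π_*` — exact (tame gerbe) and LEFT adjoint to `π^*` by the weight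
decomposition `𝓕 = 𝓕₀ ⊕ 𝓕₁`, `Hom(𝓕, π^*E) = Hom(𝓕₀, π^*E) = Hom(π_*𝓕, E)`.
[cite: Lieblich2007, arXiv Lemma 2.1.1.12 and Prop. 2.2.1.6 (weight decomposition); Alper2013, Def. 3.1 (π_* exact)] -/
theorem mapExtAddHom_bijective_of_leftAdjoint {F : C ⥤ D} {G : D ⥤ C} (adj : G ⊣ F)
    [G.PreservesMonomorphisms] [F.Additive] [F.Full] [F.Faithful] [PreservesFiniteLimits F]
    [PreservesFiniteColimits F] [HasExt.{w} C] [HasExt.{w'} D] [EnoughInjectives C]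
    (X Y : C) (n : ℕ) :
    Function.Bijective (F.mapExtAddHom X Y n) := by
  haveI := Functor.preservesInjectiveObjects_of_adjunction_of_preservesMonomorphisms adj
  exact F.mapExt_bijective_of_preservesInjectiveObjects X Y n

/-- **Block inclusion followed by an autoequivalence** — the comparison map `θ` of route R1.0 (i) made
REAL: for `F`, `G ⊣ F` as in `mapExtAddHom_bijective_of_leftAdjoint` and an (additive) equivalence
`Φ : D ≌ D′` (intended: the untwist `- ⊗ L^{∓1}` by the tautological root `L` on the gerbe, `L² = π^*P`,
`c₁(L) = c₁(P)/2`), the composite `F ⋙ Φ.functor` (intended: `E ↦ π^*E ⊗ L^{∓1}`) induces a BIJECTION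
`Extⁿ(X, Y) → Extⁿ(Φ(F X), Φ(F Y))` — it is again additive, exact, fully faithful, with the mono-preserving left
adjoint `Φ.inverse ⋙ G`. For SHEAVES `X = Y = E`, `n = 2` this is the R1.0 map `θ(ξ) = π^*ξ ⊗ 1` on `Ext²`; for
the route's two-term complex `E₀` (`Ext²_{X₀}(E₀, E₀)` of dimension `18`) the analogous `θ` lives on
derived-category `Hom`s and is NOT supplied here (ref-2 (P2)).
[cite: Lieblich2007, arXiv Lemma 2.1.1.12 and Prop. 2.2.1.6; Alper2013, Def. 3.1] -/
theorem mapExtAddHom_comp_equivalence_bijective_of_leftAdjoint {F : C ⥤ D} {G : D ⥤ C} (adj : G ⊣ F)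
    [G.PreservesMonomorphisms] [F.Additive] [F.Full] [F.Faithful] [PreservesFiniteLimits F]
    [PreservesFiniteColimits F] (Φ : D ≌ D') [Φ.functor.Additive]
    [HasExt.{w} C] [HasExt.{w''} D'] [EnoughInjectives C] (X Y : C) (n : ℕ) :
    Function.Bijective ((F ⋙ Φ.functor).mapExtAddHom X Y n) := by
  haveI : Φ.inverse.PreservesMonomorphisms :=
    Functor.preservesMonomorphisms_of_adjunction Φ.toAdjunction
  have adj₂ : Φ.inverse ⊣ Φ.functor := Φ.symm.toAdjunction
  exact mapExtAddHom_bijective_of_leftAdjoint (adj₂.comp adj) X Y n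

end BlockInclusion

/-! ### The kernel clause with the REAL comparison map (carrier-free layer) -/

section KernelClause

universe w w'' v v' v'' u u' u''

variable {C : Type u} [Category.{v} C] [Abelian C] {D : Type u'} [Category.{v'} D] [Abelian D]
  {D' : Type u''} [Category.{v''} D'] [Abelian D']
  {F : C ⥤ D} {G : D ⥤ C} (adj : G ⊣ F) [G.PreservesMonomorphisms] [F.Additive] [F.Full] [F.Faithful]
  [PreservesFiniteLimits F] [PreservesFiniteColimits F] (Φ : D ≌ D') [Φ.functor.Additive]
  [HasExt.{w} C] [HasExt.{w''} D'] [EnoughInjectives C]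
  {W W' : ℕ → Type*} [∀ q, AddCommGroup (W q)] [∀ q, AddCommGroup (W' q)]
  {E : C} {σ : ∀ q, Ext.{w} E E 2 →+ W q}
  {σ' : ∀ q, Ext.{w''} ((F ⋙ Φ.functor).obj E) ((F ⋙ Φ.functor).obj E) 2 →+ W' q}

include adj

/-- **Kernel clause of R1.0 with the real `θ`.** Components `σ_q` on `Ext²_C(E, E)` (intended: `σ_q^{E}` for
a SHEAF `E` on `X₀`; the two-term complex `E₀` itself is out of reach of the real `θ`, see the module docstring)
and `σ′_q` on `Ext²_{D′}(Φ(F E), Φ(F E))` (intended: `σ_q` of `π^*E ⊗ L^{∓1}` on the gerbe) related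
through `θ = (F ⋙ Φ.functor).mapExtAddHom E E 2` by a triangular re-expansion
`σ′_q(θ ξ) = d_q(σ_q ξ) + Σ_{j<q} u_{q,j}(σ_j ξ)` (the Leibniz rule for `At(- ⊗ M)`; a hypothesis) with `d_q`
injective on the LOWER set `I` (intended `d_q = π^*`) and arbitrary `u_{q,j}`: `(σ_q)_{q ∈ I}` is jointly
injective iff `(σ′_q)_{q ∈ I}` is. The bijection `θ` is REAL (`mapExtAddHom_comp_equivalence_bijective_of_leftAdjoint`);
the bookkeeping is `UntwistFullSigma.jointlyInjective_iff_of_triangular`.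
[cite: BuchweitzFlenner2003, §5 (I-semiregular); Lieblich2007, arXiv Prop. 2.2.1.6] -/
theorem jointlyInjective_iff_of_leftAdjoint_comp_equivalence (d : ∀ q, W q →+ W' q)
    (u : ∀ q j, W j →+ W' q) {I : Set ℕ} (hI : IsLowerSet I)
    (hd : ∀ q ∈ I, Function.Injective (d q))
    (hσ : ∀ q ∈ I, ∀ x : Ext.{w} E E 2, σ' q ((F ⋙ Φ.functor).mapExtAddHom E E 2 x) =
      d q (σ q x) + ∑ j ∈ Finset.range q, u q j (σ j x)) :
    (∀ x : Ext.{w} E E 2, (∀ q ∈ I, σ q x = 0) → x = 0) ↔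
      ∀ x' : Ext.{w''} ((F ⋙ Φ.functor).obj E) ((F ⋙ Φ.functor).obj E) 2,
        (∀ q ∈ I, σ' q x' = 0) → x' = 0 :=
  jointlyInjective_iff_of_triangular (σ := σ) (σ' := σ')
    (AddEquiv.ofBijective ((F ⋙ Φ.functor).mapExtAddHom E E 2)
      (mapExtAddHom_comp_equivalence_bijective_of_leftAdjoint adj Φ E E 2))
    d u hI hd fun q hq x => by rw [AddEquiv.ofBijective_apply]; exact hσ q hq x

/-- **The direction route R1.0 consumes (scheme ⟹ gerbe).** If `(σ_q)_{q ∈ I}` is jointly injective on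
`Ext²_C(E, E)` (intended: a sheaf `E` that is `I`-semiregular on `X₀`), then so is `(σ′_q)_{q ∈ I}` on
`Ext²_{D′}(Φ(F E), Φ(F E))` (intended: `π^*E ⊗ L^{∓1}` on `𝔊₀`, where Pridham's obstruction theory runs). Only
the SURJECTIVITY of `θ` is used — every class in `Ext²_{𝔊₀}` of the untwisted pull-back comes from `X₀`, which
is exactly the content of the block-inclusion comparison — together with injectivity of the diagonal. (For the
two-term complex `E₀` of the route the same bookkeeping is `UntwistFullSigma.jointlyInjective_of_triangular_of_surjective`
with the surjectivity of the derived `θ` as a hypothesis.)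
[cite: BuchweitzFlenner2003, §5 (I-semiregular); Lieblich2007, arXiv Lemma 2.1.1.12] -/
theorem jointlyInjective_of_leftAdjoint_comp_equivalence (d : ∀ q, W q →+ W' q)
    (u : ∀ q j, W j →+ W' q) {I : Set ℕ} (hI : IsLowerSet I)
    (hd : ∀ q ∈ I, Function.Injective (d q))
    (hσ : ∀ q ∈ I, ∀ x : Ext.{w} E E 2, σ' q ((F ⋙ Φ.functor).mapExtAddHom E E 2 x) =
      d q (σ q x) + ∑ j ∈ Finset.range q, u q j (σ j x))
    (h : ∀ x : Ext.{w} E E 2, (∀ q ∈ I, σ q x = 0) → x = 0)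
    (x' : Ext.{w''} ((F ⋙ Φ.functor).obj E) ((F ⋙ Φ.functor).obj E) 2)
    (hx' : ∀ q ∈ I, σ' q x' = 0) : x' = 0 :=
  jointlyInjective_of_triangular_of_surjective (σ := σ) (σ' := σ')
    ((F ⋙ Φ.functor).mapExtAddHom E E 2)
    (mapExtAddHom_comp_equivalence_bijective_of_leftAdjoint adj Φ E E 2).surjective d u hI hd hσ h x' hx'

/-- **Retraction form of the diagonal hypothesis.** In R1.0 the diagonal is `d_q = π^*` on
`H^{q+2}(Ω^q)`, injective because it has the retraction `r_q = π_*` (`π_* ∘ π^* = id`; for the tame gerbe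
even an isomorphism). With `r_q ∘ d_q = id` on `I` in place of injectivity, the kernel clause reads the
same. [cite: BuchweitzFlenner2003, §5 (I-semiregular); Alper2013, Prop. 4.5 (projection formula)] -/
theorem jointlyInjective_iff_of_leftAdjoint_comp_equivalence_of_retraction (d : ∀ q, W q →+ W' q)
    (r : ∀ q, W' q →+ W q) (u : ∀ q j, W j →+ W' q) {I : Set ℕ} (hI : IsLowerSet I)
    (hr : ∀ q ∈ I, ∀ y : W q, r q (d q y) = y)
    (hσ : ∀ q ∈ I, ∀ x : Ext.{w} E E 2, σ' q ((F ⋙ Φ.functor).mapExtAddHom E E 2 x) =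
      d q (σ q x) + ∑ j ∈ Finset.range q, u q j (σ j x)) :
    (∀ x : Ext.{w} E E 2, (∀ q ∈ I, σ q x = 0) → x = 0) ↔
      ∀ x' : Ext.{w''} ((F ⋙ Φ.functor).obj E) ((F ⋙ Φ.functor).obj E) 2,
        (∀ q ∈ I, σ' q x' = 0) → x' = 0 :=
  jointlyInjective_iff_of_leftAdjoint_comp_equivalence adj Φ d u hI
    (fun q hq => Function.LeftInverse.injective (hr q hq)) hσ

end KernelClause

/-! ### Real SOURCE carriers: `σ_q = sigmaHigher hE q` on `X/S`, abstract target on the gerbe side -/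

section Sigma

open Literature.AlgebraicGeometry.Motives Literature.AlgebraicGeometry.HodgeTheory
  Literature.AlgebraicGeometry.Modules

universe w w'' v' v'' u u' u''

variable {S : Type u} [CommRing S] {X : Over (Spec (CommRingCat.of S))} [HasExt.{w} X.left.Modules]
  {D : Type u'} [Category.{v'} D] [Abelian D] {D' : Type u''} [Category.{v''} D'] [Abelian D']
  {F : X.left.Modules ⥤ D} {G : D ⥤ X.left.Modules} (adj : G ⊣ F) [G.PreservesMonomorphisms]
  [F.Additive] [F.Full] [F.Faithful] [PreservesFiniteLimits F] [PreservesFiniteColimits F]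
  (Φ : D ≌ D') [Φ.functor.Additive] [HasExt.{w''} D']
  {E : X.left.Modules} (hE : IsFiniteLocallyFree E)
  {W' : ℕ → Type*} [∀ q, AddCommGroup (W' q)]
  (σ' : ∀ q, Ext.{w''} ((F ⋙ Φ.functor).obj E) ((F ⋙ Φ.functor).obj E) 2 →+ W' q)

include adj

/-- **`I`-semiregularity of `E` on `X/S` versus joint injectivity on the gerbe side, real source
carriers.** `E` finite locally free on `X/S` with Buchweitz–Flenner components
`σ_q = sigmaHigher hE q : Ext²(E, E) → H^{q+2}(X, Ω^q_{X/S})`; `F : Mod(𝒪_X) ⥤ D` a block inclusion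
(additive, exact, fully faithful, right adjoint of a mono-preserving `G` — intended `π^*`, `G = π_*`; enough
injectives in `Mod(𝒪_X)` is the tree instance, Hartshorne III.2.2), `Φ : D ≌ D′` (intended `- ⊗ L^{∓1}`),
`σ′_q` ANY additive components on `Ext²_{D′}(Φ(F E), Φ(F E))` (intended `σ_q^{E′}`, `E′ = π^*E ⊗ L^{∓1}`; no
gerbe carrier exists in the tree) which are the triangular re-expansion of the `σ_q` through the real
`θ = (F ⋙ Φ.functor).mapExtAddHom E E 2` with diagonal injective on the lower set `I`. Then
`IsISemiregular hE I ⟺ (σ′_q)_{q ∈ I}` jointly injective. [cite: BuchweitzFlenner2003, §5 (I-semiregular);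
Lieblich2007, arXiv Prop. 2.2.1.6; Hartshorne1977, III.2.2] -/
theorem isISemiregular_iff_jointlyInjective_of_leftAdjoint_comp_equivalence
    (d : ∀ q, hodgeCohomology X q (q + 2) →+ W' q)
    (u : ∀ q j, hodgeCohomology X j (j + 2) →+ W' q) {I : Set ℕ} (hI : IsLowerSet I)
    (hd : ∀ q ∈ I, Function.Injective (d q))
    (hσ : ∀ q ∈ I, ∀ x : Ext.{w} E E 2, σ' q ((F ⋙ Φ.functor).mapExtAddHom E E 2 x) =
      d q (sigmaHigher hE q x) + ∑ j ∈ Finset.range q, u q j (sigmaHigher hE j x)) :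
    IsISemiregular.{w} hE I ↔
      ∀ x' : Ext.{w''} ((F ⋙ Φ.functor).obj E) ((F ⋙ Φ.functor).obj E) 2,
        (∀ q ∈ I, σ' q x' = 0) → x' = 0 :=
  jointlyInjective_iff_of_leftAdjoint_comp_equivalence adj Φ (σ := fun q => sigmaHigher hE q) (σ' := σ')
    d u hI hd hσ

/-- **FULL semiregularity** (`I = univ`: all `σ_q`, `q ≥ 0`) of `E` on `X/S` versus joint injectivity of
all `σ′_q` on the gerbe side — the R1.0 clause «`σ_{E₀′}` injective iff `σ_{E₀}` is», FULL map, with the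
`Ext²` identification REAL. [cite: BuchweitzFlenner2003, Def. 4.1 and §5; Lieblich2007, arXiv Prop. 2.2.1.6] -/
theorem isISemiregular_univ_iff_jointlyInjective_of_leftAdjoint_comp_equivalence
    (d : ∀ q, hodgeCohomology X q (q + 2) →+ W' q)
    (u : ∀ q j, hodgeCohomology X j (j + 2) →+ W' q) (hd : ∀ q, Function.Injective (d q))
    (hσ : ∀ (q : ℕ) (x : Ext.{w} E E 2), σ' q ((F ⋙ Φ.functor).mapExtAddHom E E 2 x) =
      d q (sigmaHigher hE q x) + ∑ j ∈ Finset.range q, u q j (sigmaHigher hE j x)) :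
    IsISemiregular.{w} hE Set.univ ↔
      ∀ x' : Ext.{w''} ((F ⋙ Φ.functor).obj E) ((F ⋙ Φ.functor).obj E) 2,
        (∀ q, σ' q x' = 0) → x' = 0 := by
  rw [isISemiregular_iff_jointlyInjective_of_leftAdjoint_comp_equivalence adj Φ hE σ' d u isLowerSet_univ
    (fun q _ => hd q) fun q _ => hσ q]
  simp only [Set.mem_univ, forall_const]

/-- **The direction route R1.0 consumes, FULL map, real source carriers**: a finite locally free `E` fully
semiregular on `X/S` (FULL `σ` injective) ⟹ all `σ′_q` jointly injective on `Ext²_{D′}(Φ(F E), Φ(F E))`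
(intended: `π^*E ⊗ L^{∓1}` fully semiregular on `𝔊₀`), given the block inclusion `G ⊣ F`, the untwist `Φ`,
injective diagonals (intended `π^*` on Hodge cohomology) and the Leibniz-rule re-expansion. (Sheaf carriers
only; the route's complex `E₀` is out of reach of `sigmaHigher`, see the module docstring.)
[cite: BuchweitzFlenner2003, Def. 4.1 and §5; Lieblich2007, arXiv Lemma 2.1.1.12] -/
theorem jointlyInjective_of_isISemiregular_univ_of_leftAdjoint_comp_equivalence
    (d : ∀ q, hodgeCohomology X q (q + 2) →+ W' q)
    (u : ∀ q j, hodgeCohomology X j (j + 2) →+ W' q) (hd : ∀ q, Function.Injective (d q))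
    (hσ : ∀ (q : ℕ) (x : Ext.{w} E E 2), σ' q ((F ⋙ Φ.functor).mapExtAddHom E E 2 x) =
      d q (sigmaHigher hE q x) + ∑ j ∈ Finset.range q, u q j (sigmaHigher hE j x))
    (h : IsISemiregular.{w} hE Set.univ)
    (x' : Ext.{w''} ((F ⋙ Φ.functor).obj E) ((F ⋙ Φ.functor).obj E) 2) (hx' : ∀ q, σ' q x' = 0) :
    x' = 0 :=
  (isISemiregular_univ_iff_jointlyInjective_of_leftAdjoint_comp_equivalence adj Φ hE σ' d u hd hσ).1 h x' hx'

end Sigma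

end Summit.Ventures.HSemireg
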